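import Literature.Probability.LatticeModels.SixVertexCylinderLimit

/-!
# Six-vertex model: the cylinder window probabilities form a consistent, symmetric,
# finitely additive `[0,1]`-valued family (DKLM 2026, Lemma 22 / Lemma 97 (2))

H. Duminil-Copin, K. K. Kozlowski, P. Lammers, I. Manolescu, *Gaussian free field convergence of
the six-vertex model with `-1 ≤ Δ ≤ -1/2`*, arXiv:2603.06268 (2026) [DKLM2026SixVertexGFF]:
Lemma 22 / Lemma 97 (2) assert that the `M → ∞` limits of `ℙ_{𝕋_{M,L}}[· | balanced]` define a
probability MEASURE `ℙ_{CYL_L}` on arrow configurations of the cylinder, inheriting the symmetries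
of the torus measures. For the window probabilities
`cylinderWindowProb c ℓ n S = ℙ_{CYL_{2ℓ}}[window_n ∈ S]` of
`Literature/Probability/LatticeModels/SixVertexCylinderLimit.lean` this file records exactly the
finitely-additive content of that statement (everything short of the Kolmogorov extension):

* `torusCondProbNat_nonneg`, `torusCondProbNat_le_one`, `torusCondProbNat_union` (additivity on
  disjoint pattern sets), `torusCondProbNat_univ` (`= 1` on the torus `ZMod (m+1) × ZMod (2(ℓ+1))`,
  a balanced ice configuration of weight `1` exists), `torusWindow_mono` (a smaller window event
  is a larger window event, uniformly in the torus size);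
* for `c > 0`: `cylinderWindowProb_nonneg`, `_le_one`, `_union`, `_univ`, `_flip_preimage`
  (arrow-reversal symmetry), `_mono` (consistency under enlarging the window), `_shift`
  (translation invariance: a translated window event has the same cylinder probability as the
  corresponding larger window event).

## References

* H. Duminil-Copin, K. K. Kozlowski, P. Lammers, I. Manolescu, arXiv:2603.06268 (2026),
  Lemma 22, Lemma 97 (2). [DKLM2026SixVertexGFF]
-/

noncomputable section

open Finset Filter Topology

namespace Literature.Probability.LatticeModels.SixVertex

/-! ### The torus conditional probabilities take values in `[0, 1]` and are additive -/

section Torus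

variable {G₁ G₂ : Type*} [AddGroup G₁] [AddGroup G₂] [One G₁] [One G₂]
  [Fintype G₁] [Fintype G₂] [DecidableEq G₁] [DecidableEq G₂]

omit [Fintype G₁] [Fintype G₂] [DecidableEq G₁] [DecidableEq G₂] in
/-- Vertex weights are nonnegative for nonnegative `a, b, c`. [folklore] -/
theorem vertexWeight_nonneg {a b c : ℝ} (ha : 0 ≤ a) (hb : 0 ≤ b) (hc : 0 ≤ c)
    (ω : Config (G₁ × G₂)) (v : G₁ × G₂) : 0 ≤ vertexWeight a b c ω v := by
  rw [vertexWeight_eq_localWeight]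
  exact localWeight_nonneg ha hb hc _ _ _ _

omit [DecidableEq G₁] [DecidableEq G₂] in
/-- Torus weights are nonnegative for nonnegative `a, b, c`. [folklore] -/
theorem torusWeight_nonneg {a b c : ℝ} (ha : 0 ≤ a) (hb : 0 ≤ b) (hc : 0 ≤ c)
    (ω : Config (G₁ × G₂)) : 0 ≤ torusWeight a b c ω :=
  Finset.prod_nonneg fun v _ => vertexWeight_nonneg ha hb hc ω v

/-- `0 ≤ ℙ_𝕋[A | balanced]`. [folklore] -/
theorem torusCondProb_nonneg {a b c : ℝ} (ha : 0 ≤ a) (hb : 0 ≤ b) (hc : 0 ≤ c)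
    (A : Set (Config (G₁ × G₂))) : 0 ≤ torusCondProb a b c A := by
  classical
  unfold torusCondProb
  exact div_nonneg (Finset.sum_nonneg fun ω _ => torusWeight_nonneg ha hb hc ω)
    (Finset.sum_nonneg fun ω _ => torusWeight_nonneg ha hb hc ω)

/-- `ℙ_𝕋[A | balanced] ≤ 1`. [folklore] -/
theorem torusCondProb_le_one {a b c : ℝ} (ha : 0 ≤ a) (hb : 0 ≤ b) (hc : 0 ≤ c)
    (A : Set (Config (G₁ × G₂))) : torusCondProb a b c A ≤ 1 := by
  classical
  unfold torusCondProb
  refine div_le_one_of_le₀ ?_ (Finset.sum_nonneg fun ω _ => torusWeight_nonneg ha hb hc ω)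
  refine Finset.sum_le_sum_of_subset_of_nonneg (fun ω hω => ?_)
    (fun ω _ _ => torusWeight_nonneg ha hb hc ω)
  simp only [Finset.mem_filter, Finset.mem_univ, true_and] at hω ⊢
  exact hω.1

/-- **Additivity**: `ℙ_𝕋[A ∪ B | balanced] = ℙ_𝕋[A | balanced] + ℙ_𝕋[B | balanced]` for disjoint
events. [folklore] -/
theorem torusCondProb_union (a b c : ℝ) {A B : Set (Config (G₁ × G₂))} (hAB : Disjoint A B) :
    torusCondProb a b c (A ∪ B) = torusCondProb a b c A + torusCondProb a b c B := by
  classical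
  unfold torusCondProb
  rw [← add_div]
  congr 1
  rw [← Finset.sum_union]
  · congr 1
    ext ω
    simp only [Finset.mem_filter, Finset.mem_univ, true_and, Set.mem_union, Finset.mem_union]
    tauto
  · rw [Finset.disjoint_filter]
    intro ω _ h1 h2
    exact Set.disjoint_left.mp hAB h1.2 h2.2

end Torus

/-- `0 ≤ ℙ_{𝕋_{M,L}}[window ∈ S | balanced]`. [folklore] -/
theorem torusCondProbNat_nonneg {a b c : ℝ} (ha : 0 ≤ a) (hb : 0 ≤ b) (hc : 0 ≤ c) (M L n : ℕ)
    (S : Set (Config (Fin (2 * n + 1) × Fin (2 * n + 1)))) : 0 ≤ torusCondProbNat a b c M L n S := by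
  unfold torusCondProbNat
  split_ifs with hM hL
  · exact le_rfl
  · exact le_rfl
  · haveI : NeZero M := ⟨hM⟩
    haveI : NeZero L := ⟨hL⟩
    exact torusCondProb_nonneg ha hb hc _

/-- `ℙ_{𝕋_{M,L}}[window ∈ S | balanced] ≤ 1`. [folklore] -/
theorem torusCondProbNat_le_one {a b c : ℝ} (ha : 0 ≤ a) (hb : 0 ≤ b) (hc : 0 ≤ c) (M L n : ℕ)
    (S : Set (Config (Fin (2 * n + 1) × Fin (2 * n + 1)))) : torusCondProbNat a b c M L n S ≤ 1 := by
  unfold torusCondProbNat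
  split_ifs with hM hL
  · exact zero_le_one
  · exact zero_le_one
  · haveI : NeZero M := ⟨hM⟩
    haveI : NeZero L := ⟨hL⟩
    exact torusCondProb_le_one ha hb hc _

/-- Additivity of `ℙ_{𝕋_{M,L}}[window ∈ · | balanced]` on disjoint pattern sets. [folklore] -/
theorem torusCondProbNat_union (a b c : ℝ) (M L n : ℕ)
    {S T : Set (Config (Fin (2 * n + 1) × Fin (2 * n + 1)))} (hST : Disjoint S T) :
    torusCondProbNat a b c M L n (S ∪ T) =
      torusCondProbNat a b c M L n S + torusCondProbNat a b c M L n T := by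
  unfold torusCondProbNat
  split_ifs with hM hL
  · simp
  · simp
  · haveI : NeZero M := ⟨hM⟩
    haveI : NeZero L := ⟨hL⟩
    rw [← torusCondProb_union]
    · rfl
    · exact Set.disjoint_left.mpr fun ω h1 h2 => Set.disjoint_left.mp hST h1 h2

/-- A balanced ice configuration of weight `1` on the torus `ZMod M × ZMod (2(ℓ+1))`: horizontal
arrows east exactly on the first `ℓ + 1` rows, all vertical arrows north. [folklore] -/
theorem torusWeight_halfEast_allNorth (c : ℝ) (M ℓ : ℕ) [NeZero M] :
    torusWeight 1 1 c (fun v : ZMod M × ZMod (2 * (ℓ + 1)) =>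
      (decide (ZMod.val v.2 < ℓ + 1), true)) = 1 := by
  unfold torusWeight
  refine Finset.prod_eq_one fun v _ => ?_
  rw [vertexWeight_eq_localWeight]
  simp only
  rw [localWeight_self_true_true]
  split_ifs <;> rfl

/-- **`ℙ_{𝕋_{M,2(ℓ+1)}}[window ∈ univ | balanced] = 1`** for `M ≠ 0` (the balanced partition
function is positive: a balanced ice configuration of weight `1` exists). [folklore] -/
theorem torusCondProbNat_univ (c : ℝ) (hc : 0 ≤ c) (M ℓ n : ℕ) (hM : M ≠ 0) :
    torusCondProbNat 1 1 c M (2 * (ℓ + 1)) n Set.univ = 1 := by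
  classical
  haveI : NeZero M := ⟨hM⟩
  unfold torusCondProbNat
  rw [dif_neg hM, dif_neg (by omega)]
  unfold torusCondProb
  simp only [Finset.sum_filter, Set.mem_setOf_eq, Set.mem_univ, and_true]
  refine div_self (ne_of_gt ?_)
  set ω₀ : Config (ZMod M × ZMod (2 * (ℓ + 1))) :=
    fun v => (decide (ZMod.val v.2 < ℓ + 1), true) with hω₀
  have hbal : IsBalanced ω₀ := fun x => isBalancedCol_val_lt ℓ
  have h1 : torusWeight 1 1 c ω₀ = 1 := torusWeight_halfEast_allNorth c M ℓ
  have hterm : (1 : ℝ) = if IsBalanced ω₀ then torusWeight 1 1 c ω₀ else 0 := by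
    rw [if_pos hbal, h1]
  calc (0 : ℝ) < 1 := one_pos
    _ = (if IsBalanced ω₀ then torusWeight 1 1 c ω₀ else 0) := hterm
    _ ≤ _ := Finset.single_le_sum
        (f := fun ω : Config (ZMod M × ZMod (2 * (ℓ + 1))) =>
          if IsBalanced ω then torusWeight 1 1 c ω else 0)
        (fun ω _ => by
          split_ifs
          · exact torusWeight_nonneg zero_le_one zero_le_one hc ω
          · exact le_rfl)
        (Finset.mem_univ ω₀)

/-- **A smaller window event is a larger window event, uniformly in the torus size**: for `m ≤ n`
and a pattern set `S` of size `m` there is a pattern set `T` of size `n` cutting out the same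
event in the plane and on every torus. [folklore] -/
theorem torusWindow_mono {m n : ℕ} (hmn : m ≤ n)
    (S : Set (Config (Fin (2 * m + 1) × Fin (2 * m + 1)))) :
    ∃ T : Set (Config (Fin (2 * n + 1) × Fin (2 * n + 1))),
      {ω : Config (ℤ × ℤ) | planeWindow m ω ∈ S} = {ω | planeWindow n ω ∈ T} ∧
        ∀ M L : ℕ, {ω : Config (ZMod M × ZMod L) | torusWindow m ω ∈ S} =
          {ω | torusWindow n ω ∈ T} := by
  refine ⟨{w | (fun p : Fin (2 * m + 1) × Fin (2 * m + 1) =>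
    w (⟨p.1 + (n - m), by omega⟩, ⟨p.2 + (n - m), by omega⟩)) ∈ S}, ?_, fun M L => ?_⟩
  · ext ω
    simp only [Set.mem_setOf_eq]
    suffices h : (fun p : Fin (2 * m + 1) × Fin (2 * m + 1) =>
        planeWindow n ω (⟨p.1 + (n - m), by omega⟩, ⟨p.2 + (n - m), by omega⟩)) =
        planeWindow m ω by
      rw [h]
    funext p
    simp only [planeWindow]
    congr 2 <;> push_cast [Nat.cast_sub hmn] <;> ring
  · ext ω
    simp only [Set.mem_setOf_eq]
    suffices h : (fun p : Fin (2 * m + 1) × Fin (2 * m + 1) =>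
        torusWindow n ω (⟨p.1 + (n - m), by omega⟩, ⟨p.2 + (n - m), by omega⟩)) =
        torusWindow m ω by
      rw [h]
    funext p
    simp only [torusWindow]
    congr 3 <;> push_cast [Nat.cast_sub hmn] <;> ring

/-! ### Consequences for the cylinder window probabilities `ℙ_{CYL_{2ℓ}}[window_n ∈ S]` -/

/-- `0 ≤ ℙ_{CYL_{2ℓ}}[window_n ∈ S]`. [cite: DKLM2026SixVertexGFF, Lemma 22] -/
theorem cylinderWindowProb_nonneg (c : ℝ) (hc : 0 < c) (ℓ n : ℕ)
    (S : Set (Config (Fin (2 * n + 1) × Fin (2 * n + 1)))) : 0 ≤ cylinderWindowProb c ℓ n S :=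
  ge_of_tendsto' (tendsto_cylinderWindowProb c hc ℓ n S) fun M =>
    torusCondProbNat_nonneg zero_le_one zero_le_one hc.le M _ n S

/-- `ℙ_{CYL_{2ℓ}}[window_n ∈ S] ≤ 1`. [cite: DKLM2026SixVertexGFF, Lemma 22] -/
theorem cylinderWindowProb_le_one (c : ℝ) (hc : 0 < c) (ℓ n : ℕ)
    (S : Set (Config (Fin (2 * n + 1) × Fin (2 * n + 1)))) : cylinderWindowProb c ℓ n S ≤ 1 :=
  le_of_tendsto' (tendsto_cylinderWindowProb c hc ℓ n S) fun M =>
    torusCondProbNat_le_one zero_le_one zero_le_one hc.le M _ n S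

/-- **Finite additivity** of `ℙ_{CYL_{2ℓ}}[window_n ∈ ·]`. [cite: DKLM2026SixVertexGFF, Lemma 22] -/
theorem cylinderWindowProb_union (c : ℝ) (hc : 0 < c) (ℓ n : ℕ)
    {S T : Set (Config (Fin (2 * n + 1) × Fin (2 * n + 1)))} (hST : Disjoint S T) :
    cylinderWindowProb c ℓ n (S ∪ T) = cylinderWindowProb c ℓ n S + cylinderWindowProb c ℓ n T := by
  refine tendsto_nhds_unique (tendsto_cylinderWindowProb c hc ℓ n (S ∪ T)) ?_
  have h := (tendsto_cylinderWindowProb c hc ℓ n S).add (tendsto_cylinderWindowProb c hc ℓ n T)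
  exact h.congr fun M => (torusCondProbNat_union 1 1 c M _ n hST).symm

/-- **Normalisation**: `ℙ_{CYL_{2(ℓ+1)}}[window_n ∈ univ] = 1`. [cite: DKLM2026SixVertexGFF, Lemma 22] -/
theorem cylinderWindowProb_univ (c : ℝ) (hc : 0 < c) (ℓ n : ℕ) :
    cylinderWindowProb c (ℓ + 1) n Set.univ = 1 := by
  refine tendsto_nhds_unique (tendsto_cylinderWindowProb c hc (ℓ + 1) n Set.univ) ?_
  refine (tendsto_const_nhds (x := (1 : ℝ))).congr' ?_
  filter_upwards [eventually_ne_atTop 0] with M hM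
  exact (torusCondProbNat_univ c hc.le M ℓ n hM).symm

/-- **Arrow-reversal symmetry** of the cylinder window probabilities.
[cite: DKLM2026SixVertexGFF, Lemma 22 and §2.1] -/
theorem cylinderWindowProb_flip_preimage (c : ℝ) (ℓ n : ℕ)
    (S : Set (Config (Fin (2 * n + 1) × Fin (2 * n + 1)))) :
    cylinderWindowProb c ℓ n {w | (fun p => (!(w p).1, !(w p).2)) ∈ S} =
      cylinderWindowProb c ℓ n S := by
  unfold cylinderWindowProb
  simp only [torusCondProbNat_flip_preimage]

/-- **Consistency under enlarging the window**: the cylinder probability of a window-`m` event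
equals that of the same event read in any larger window `n ≥ m`. [cite: DKLM2026SixVertexGFF, Lemma 22] -/
theorem cylinderWindowProb_mono (c : ℝ) (ℓ : ℕ) {m n : ℕ} (hmn : m ≤ n)
    (S : Set (Config (Fin (2 * m + 1) × Fin (2 * m + 1)))) :
    ∃ T : Set (Config (Fin (2 * n + 1) × Fin (2 * n + 1))),
      {ω : Config (ℤ × ℤ) | planeWindow m ω ∈ S} = {ω | planeWindow n ω ∈ T} ∧
        cylinderWindowProb c ℓ m S = cylinderWindowProb c ℓ n T := by
  obtain ⟨T, hplane, htorus⟩ := torusWindow_mono hmn S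
  refine ⟨T, hplane, ?_⟩
  unfold cylinderWindowProb
  congr 1
  funext M
  unfold torusCondProbNat
  split_ifs with hM hL
  · rfl
  · rfl
  · rw [htorus]

/-- **Translation invariance**: the cylinder probability of a translated window event equals that
of the corresponding (larger) window event. [cite: DKLM2026SixVertexGFF, Lemma 22 and Thm. 2.2] -/
theorem cylinderWindowProb_shift (c : ℝ) (ℓ n : ℕ) (v : ℤ × ℤ)
    (S : Set (Config (Fin (2 * n + 1) × Fin (2 * n + 1)))) :
    ∃ (n' : ℕ) (S' : Set (Config (Fin (2 * n' + 1) × Fin (2 * n' + 1)))),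
      {ω : Config (ℤ × ℤ) | planeWindow n (fun w => ω (w + v)) ∈ S} =
          {ω | planeWindow n' ω ∈ S'} ∧
        cylinderWindowProb c ℓ n' S' = cylinderWindowProb c ℓ n S := by
  obtain ⟨n', S', hplane, htorus⟩ := window_shift n v S
  refine ⟨n', S', hplane, ?_⟩
  unfold cylinderWindowProb
  congr 1
  funext M
  unfold torusCondProbNat
  split_ifs with hM hL
  · rfl
  · rfl
  · haveI : NeZero M := ⟨hM⟩
    haveI : NeZero (2 * ℓ) := ⟨hL⟩
    rw [htorus M (2 * ℓ)]
    exact torusCondProb_shift_preimage (G₁ := ZMod M) (G₂ := ZMod (2 * ℓ)) 1 1 c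
      ((v.1 : ZMod M), (v.2 : ZMod (2 * ℓ))) {ω | torusWindow n ω ∈ S}

end Literature.Probability.LatticeModels.SixVertex

end
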